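import Mathlib.Algebra.Module.Lattice
import Literature.NumberTheory.Automorphic.UnitaryLatticeTreeStabilizer     -- ★ `mapGL_latt_eq_latt_iff` (brings ★ T1a `latt`, `mapGL`, `IsIntMatrix`, `stdLattice`; ★ T1b `latt_le_latt_iff`)
import Literature.NumberTheory.Automorphic.UnitaryLatticeTreeFramed         -- ★ `latt_eq_span_col`, `linearIndependent_integer_iff`, `linearIndependent_integer_col`
import Literature.NumberTheory.Automorphic.ValuedFieldValuativeRelBridge    -- ★ `mem_glInt_iff_forall_v_le_one` (the `Valued` ∕ `ValuativeRel` dictionary for `glInt`)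
import HarnessLib

/-!
# R90 · S6 «Ch. 14.1–14.5 stable TF» — WAVE 7 card W7-f (i): THE COSET ↔ LATTICE DICTIONARY for `GL_N` over a discretely valued field
# `g·GL_N(𝒪) = g′·GL_N(𝒪) ⟺ g·𝒪^N = g′·𝒪^N`, `Stab(g·𝒪^N) = g·GL_N(𝒪)·g⁻¹`, and «`𝒪`-lattice of `K^N`» `⟺` «`g·𝒪^N` for some `g ∈ GL_N(K)`»
# (`Theorems/R90S6GLCosetLatticeDict.lean`)

Cell `hodgecm-mathlib`, crux H413 (`stmt-HodgeConjecture-24833`), route `HCCMUnconditional`; programme R90-TF, section S6 (base `R90-C14`, dealer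
R90-C14-plan (g2)), seat R90-C14-p10 (g0); card **W7-f** of the S6 WAVE 7 menu (`R90/R90-szE1.1/g3/CLOSURE-E1.1.md` §3, DAG row E1.4.3.1.1 «vertex model of
`GL₃(L_w) ∕ K_E`; coset ↔ lattice dictionary to-build»).  Lane `--kind proof --supports stmt-HodgeConjecture-24833` (helper; THEOREMS ONLY: no definition, no
instance, no notation, no named fact, no `sorry`).  Imports: ★ Literature (`UnitaryLatticeTreeStabilizer`, `UnitaryLatticeTreeFramed`, `ValuedFieldValuativeRelBridge`)
+ Mathlib `Algebra.Module.Lattice` + HarnessLib; no `Cruxes` import.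

THE MATHEMATICS (Serre, *Trees* II.1.1; Garrett, *Buildings* 18.2–18.3; Macdonald V §2).  `K` a field carrying `Valued K ℤᵐ⁰` (the currency of the tree's lattice
files: `latt g = g·𝒪^N`, `mapGL γ M = γ·M`, `IsIntMatrix`) AND Mathlib's `ValuativeRel K` compatible with it (the currency of the tree's `GL_n` files: `glInt N K =
GL_N(𝒪)`, `zpowDiagGL`, the Cartan decomposition) — both registered on every `L_w = w.adicCompletion L` (★ `AdicCompletionLocalField`), bridged by ★
`ValuedFieldValuativeRelBridge`.  `GL_N(K)` acts on the full-rank `𝒪`-lattices of `K^N`; the orbit of the root `L₀ = 𝒪^N` is all of them and its stabiliser is `GL_N(𝒪)`: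
* §1 **`latt_eq_latt_iff_mem_glInt`: `g·𝒪^N = g′·𝒪^N ⟺ g⁻¹g′ ∈ GL_N(𝒪)`** (so `gK ↦ g·𝒪^N` is well defined and injective on `GL_N(K) ∕ GL_N(𝒪)`), from ★ `latt_le_latt_iff`;
* §2 **`mapGL_latt_eq_latt_iff_mem_glInt`: `γ·(g·𝒪^N) = g·𝒪^N ⟺ g⁻¹γg ∈ GL_N(𝒪)`** = ★ `mapGL_latt_eq_latt_iff` read through the bridge, i.e. `Stab(g·𝒪^N) = g·GL_N(𝒪)·g⁻¹`
  (`mapGL_latt_eq_latt_iff_mem_map_conj`), and `Stab(𝒪^N) = GL_N(𝒪)` (`mapGL_stdLattice_eq_iff_mem_glInt`);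
* §3 (surjectivity onto Mathlib's intrinsic lattices) **`isLattice_latt`**: `g·𝒪^N` is a `Submodule.IsLattice` (finitely generated, spans `K^N`), and conversely, when `𝒪` is a
  principal ideal ring (a DVR), **`exists_eq_latt_of_isLattice`**: every `𝒪`-lattice `M ⊂ K^N` is `g·𝒪^N` for some `g ∈ GL_N(K)` (a lattice over a PID is free of rank `N`,
  Mathlib `Submodule.IsLattice.free` ∕ `finrank_of_pi`; its basis vectors are the columns of an invertible `g`); packaged as **`exists_eq_latt_iff_isLattice`**.
The `Equiv` `GL_N(K) ∕ GL_N(𝒪) ≃ {lattices}` itself (a definition) and the elementary-divisor half of the card are the sequel files `R90S6GLCosetLattice`,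
`R90S6GLCosetInvariants`.  WHY ON PATH: E1.4.3.1 (vertex model of `GL₃(L_w) ∕ K_E` carrying the twisted polarity `P_δ`, [Kt₁] road J) and E1.4.4.2.2 (lattice
geometry of `GL₃(L_w)` relative to the unitary tree) move freely between cosets `gK_E`, where the twisted orbital integrals live, and lattices `gΛ₀`, where
self-duality and incidence are computed; this file is that bridge, by name, at every rank `N`.
HONEST LABEL: elementary lattice algebra over a valuation ring; proves no printed global statement, discharges no citation; count-neutral helper until
E1.4.3.1 ∕ E1.4.4.2.2 consume it.  HC_CM is proved only modulo the 7 printed citations (2 remaining named inputs: hLiu418 = stmt-HodgeConjecture-24832,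
h413 = stmt-HodgeConjecture-24833) until rung 0 closes.

## References
* [Serre1980Trees] J.-P. Serre, *Trees* (1980), Ch. II §1.1 (lattices `g·𝒪²`; `GL₂(𝒪)` is the stabiliser of `𝒪²`; vertices = lattice classes = `G ∕ K·Z`).
* [Macdonald1995] I. G. Macdonald, *Symmetric Functions and Hall Polynomials*, 2nd ed. (1995), Ch. V §2 (PDF p. 246: «`G ∕ K` may be identified with the set of
  lattices in `V`», `x ↦ Lx`).
* [BruhatTits1972] F. Bruhat, J. Tits, *Groupes réductifs sur un corps local I*, Publ. Math. IHÉS 41 (1972), §10 (lattice models, vertex stabilisers).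
-/
set_option autoImplicit false
-- the mandated namespace repeats the single-problem summit's segment (`HodgeConjecture.HodgeConjecture`)
set_option linter.dupNamespace false

noncomputable section

open scoped Valued WithZero Matrix MatrixGroups
open Literature.NumberTheory.Automorphic Literature.NumberTheory.Automorphic.HermitianLattice Literature.NumberTheory.Automorphic.UnitaryLatticeTree

namespace Summit.HodgeConjecture.HodgeConjecture.R90.S6

variable {K : Type*} [Field K] [Valued K ℤᵐ⁰] [ValuativeRel K] [(Valued.v : Valuation K ℤᵐ⁰).Compatible] {N : ℕ}

/-! ## §1 `g·𝒪^N = g′·𝒪^N ⟺ g⁻¹g′ ∈ GL_N(𝒪)` -/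

/-- **`GL_N(𝒪)` in the lattice files' currency**: `g ∈ glInt N K ⟺ g` and `g⁻¹` are integral matrices (`IsIntMatrix`, i.e. all entries have `Valued.v ≤ 1`) —
★ `mem_glInt_iff_forall_v_le_one` restated with ★ T1a's `IsIntMatrix`. [cite: Serre1980Trees, II.1.1] -/
theorem mem_glInt_iff_isIntMatrix (g : GL (Fin N) K) :
    g ∈ glInt N K ↔ IsIntMatrix (g : Matrix (Fin N) (Fin N) K) ∧ IsIntMatrix ((g⁻¹ : GL (Fin N) K) : Matrix (Fin N) (Fin N) K) :=
  mem_glInt_iff_forall_v_le_one g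

/-- **THE COSET ↔ LATTICE DICTIONARY: `g·𝒪^N = g′·𝒪^N ⟺ g⁻¹g′ ∈ GL_N(𝒪)`** (`⟺ gK = g′K` in `GL_N(K) ∕ GL_N(𝒪)`): `latt g′ ≤ latt g ⟺ g⁻¹g′` integral and
`latt g ≤ latt g′ ⟺ g′⁻¹g = (g⁻¹g′)⁻¹` integral (★ `latt_le_latt_iff`). [cite: Serre1980Trees, II.1.1] [cite: Macdonald1995, Ch. V §2 (PDF p. 246)] -/
theorem latt_eq_latt_iff_mem_glInt (g g' : GL (Fin N) K) :
    latt (g : Matrix (Fin N) (Fin N) K) = latt (g' : Matrix (Fin N) (Fin N) K) ↔ g⁻¹ * g' ∈ glInt N K := by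
  rw [mem_glInt_iff_isIntMatrix, le_antisymm_iff, latt_le_latt_iff (isUnit_det_coe g'), latt_le_latt_iff (isUnit_det_coe g),
    ← coe_inv_eq_nonsing_inv, ← coe_inv_eq_nonsing_inv, ← Units.val_mul, ← Units.val_mul, mul_inv_rev, inv_inv, and_comm]

/-- The same dictionary read as equality of left cosets in `GL_N(K) ⧸ GL_N(𝒪)`: `g·𝒪^N = g′·𝒪^N ⟺ (g : G ⧸ K) = g′`. [cite: Serre1980Trees, II.1.1] -/
theorem latt_eq_latt_iff_quotient_eq (g g' : GL (Fin N) K) :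
    latt (g : Matrix (Fin N) (Fin N) K) = latt (g' : Matrix (Fin N) (Fin N) K) ↔ (g : GL (Fin N) K ⧸ glInt N K) = (g' : GL (Fin N) K ⧸ glInt N K) := by
  rw [latt_eq_latt_iff_mem_glInt, QuotientGroup.eq]

/-! ## §2 Stabilisers: `Stab(g·𝒪^N) = g·GL_N(𝒪)·g⁻¹`, `Stab(𝒪^N) = GL_N(𝒪)` -/

/-- **THE STABILISER TEST in `GL_N(𝒪)`-currency: `γ·(g·𝒪^N) = g·𝒪^N ⟺ g⁻¹γg ∈ GL_N(𝒪)`** (★ `mapGL_latt_eq_latt_iff` + the bridge). [cite: Serre1980Trees, II.1.1]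
[cite: BruhatTits1972, §10] -/
theorem mapGL_latt_eq_latt_iff_mem_glInt (γ g : GL (Fin N) K) :
    mapGL γ (latt (g : Matrix (Fin N) (Fin N) K)) = latt (g : Matrix (Fin N) (Fin N) K) ↔ g⁻¹ * γ * g ∈ glInt N K := by
  rw [mapGL_latt, eq_comm, latt_eq_latt_iff_mem_glInt, mul_assoc]

/-- **`Stab_{GL_N(K)}(g·𝒪^N) = g·GL_N(𝒪)·g⁻¹`**: `γ` fixes the lattice `g·𝒪^N` iff `γ` lies in the conjugate subgroup `(glInt N K).map (conj g)`.
[cite: Serre1980Trees, II.1.1] [cite: BruhatTits1972, §10] -/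
theorem mapGL_latt_eq_latt_iff_mem_map_conj (γ g : GL (Fin N) K) :
    mapGL γ (latt (g : Matrix (Fin N) (Fin N) K)) = latt (g : Matrix (Fin N) (Fin N) K) ↔ γ ∈ (glInt N K).map (MulAut.conj g).toMonoidHom := by
  rw [mapGL_latt_eq_latt_iff_mem_glInt, Subgroup.mem_map_equiv, MulAut.conj_symm_apply]

/-- **`Stab_{GL_N(K)}(𝒪^N) = GL_N(𝒪)`**: `γ·𝒪^N = 𝒪^N ⟺ γ ∈ glInt N K` (Serre: «`GL(V) ∕ GL(L)`, `GL(L)` the stabiliser of the lattice `L`»). [cite: Serre1980Trees, II.1.1] -/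
theorem mapGL_stdLattice_eq_iff_mem_glInt (γ : GL (Fin N) K) : mapGL γ (stdLattice K N) = stdLattice K N ↔ γ ∈ glInt N K := by
  have h := mapGL_latt_eq_latt_iff_mem_glInt γ 1
  rwa [Units.val_one, latt_one, inv_one, one_mul, mul_one] at h

/-! ## §3 Every `𝒪`-lattice of `K^N` is `g·𝒪^N`: surjectivity onto Mathlib's `Submodule.IsLattice` -/

omit [ValuativeRel K] [(Valued.v : Valuation K ℤᵐ⁰).Compatible] in
/-- **`g·𝒪^N` is an `𝒪`-lattice of `K^N`** in Mathlib's intrinsic sense (`Submodule.IsLattice`: finitely generated — by the columns of `g`, ★ `latt_eq_span_col` — and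
spanning `K^N` over `K` — its `𝒪`-rank is `N`, the columns being independent, ★ `linearIndependent_integer_col`). [cite: Serre1980Trees, II.1.1] -/
theorem isLattice_latt (g : GL (Fin N) K) : Submodule.IsLattice K (latt (g : Matrix (Fin N) (Fin N) K)) := by
  classical
  refine Submodule.IsLattice.of_rank_le K ?_ ?_
  · rw [latt_eq_span_col]
    exact Submodule.fg_span (Set.finite_range _)
  · -- the `N` columns of `g` are `𝒪`-independent vectors of `latt g`
    let u : Fin N → latt (g : Matrix (Fin N) (Fin N) K) := fun j => ⟨(g : Matrix (Fin N) (Fin N) K).col j, by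
      rw [latt_eq_span_col]; exact Submodule.subset_span ⟨j, rfl⟩⟩
    have hu : LinearIndependent 𝒪[K] u := LinearIndependent.of_comp (latt (g : Matrix (Fin N) (Fin N) K)).subtype (linearIndependent_integer_col g)
    have h := hu.cardinal_lift_le_rank
    rw [Cardinal.mk_fintype, Fintype.card_fin, Cardinal.lift_natCast, Cardinal.lift_uzero] at h
    rw [rank_fin_fun]
    exact h

omit [ValuativeRel K] [(Valued.v : Valuation K ℤᵐ⁰).Compatible] in
/-- **EVERY `𝒪`-LATTICE OF `K^N` IS FRAMED: `M = g·𝒪^N` for some `g ∈ GL_N(K)`**, when `𝒪 = 𝒪[K]` is a principal ideal ring (a DVR, e.g. `K = L_w`): a lattice over a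
PID is free (Mathlib `Submodule.IsLattice.free`) of rank `N` (`Submodule.IsLattice.finrank_of_pi`); its basis, extended to `K` (`Module.Basis.extendOfIsLattice`), is a
`K`-basis of `K^N`, so the matrix `g` of basis vectors is invertible and `latt g = span_𝒪(basis) = M` (★ `latt_eq_span_col`). [cite: Serre1980Trees, II.1.1]
[cite: Macdonald1995, Ch. V §2 (PDF p. 246)] -/
theorem exists_eq_latt_of_isLattice [IsPrincipalIdealRing 𝒪[K]] (M : Submodule 𝒪[K] (Fin N → K)) [Submodule.IsLattice K M] :
    ∃ g : GL (Fin N) K, M = latt (g : Matrix (Fin N) (Fin N) K) := by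
  classical
  have hrank : Module.finrank 𝒪[K] M = N := by
    rw [Submodule.IsLattice.finrank_of_pi K M, Fintype.card_fin]
  let b : Module.Basis (Fin N) 𝒪[K] M := Module.finBasisOfFinrankEq 𝒪[K] M hrank
  -- the basis vectors, seen in `K^N`, form a `K`-basis (`extendOfIsLattice`), hence are the columns of an invertible matrix
  let w : Fin N → (Fin N → K) := fun i => (b i : Fin N → K)
  have hwK : LinearIndependent K w := by
    have h := (b.extendOfIsLattice K).linearIndependent
    have hw : ⇑(b.extendOfIsLattice K) = w := funext fun i => Module.Basis.extendOfIsLattice_apply K b i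
    rwa [hw] at h
  let g : Matrix (Fin N) (Fin N) K := Matrix.of fun i j => w j i
  have hgcol : ∀ j, g.col j = w j := fun j => by ext i; rfl
  have hgK : LinearIndependent K g.col := by
    have : g.col = w := funext hgcol
    rw [this]; exact hwK
  obtain ⟨gU, hgU⟩ := Matrix.linearIndependent_cols_iff_isUnit.1 hgK
  refine ⟨gU, ?_⟩
  rw [hgU, latt_eq_span_col]
  simp_rw [hgcol]
  have h1 : Set.range w = M.subtype '' Set.range b := by
    ext x
    simp only [Set.mem_range, Set.mem_image, exists_exists_eq_and, Submodule.coe_subtype, w]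
  rw [h1, ← Submodule.map_span, b.span_eq, Submodule.map_top, Submodule.range_subtype]

omit [ValuativeRel K] [(Valued.v : Valuation K ℤᵐ⁰).Compatible] in
/-- **«`𝒪`-lattice of `K^N`» `⟺` «`g·𝒪^N` for some `g ∈ GL_N(K)`»** (`𝒪` a principal ideal ring): the orbit of the root `𝒪^N` under `GL_N(K)` is exactly the set of
Mathlib's `Submodule.IsLattice` submodules — the surjectivity half of `GL_N(K) ∕ GL_N(𝒪) ≃ {lattices}` («`G ∕ K` may be identified with the set of lattices in `V`»).
[cite: Macdonald1995, Ch. V §2 (PDF p. 246)] [cite: Serre1980Trees, II.1.1] -/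
theorem exists_eq_latt_iff_isLattice [IsPrincipalIdealRing 𝒪[K]] (M : Submodule 𝒪[K] (Fin N → K)) :
    (∃ g : GL (Fin N) K, M = latt (g : Matrix (Fin N) (Fin N) K)) ↔ Submodule.IsLattice K M := by
  constructor
  · rintro ⟨g, rfl⟩
    exact isLattice_latt g
  · intro hM
    exact exists_eq_latt_of_isLattice M

end Summit.HodgeConjecture.HodgeConjecture.R90.S6

end
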